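import Literature.Probability.LatticeModels.KCSignConditionScale
import Literature.Probability.LatticeModels.WeakBeurlingHoleFree
import HarnessLib

/-!
# The sign-condition argument at one mesh: the Harnack chain

Topic `Literature/Probability/LatticeModels`. Continuation of `KCSignConditionScale.lean`: the
Harnack chain of the configuration at mesh `δ` — `kH = ⌊κ/δ⌋`, `cH j = plaqOf (w j / δ)` — and
the hypotheses `hkH`, `hHstep`, `hHbig` of `kc_sign_condition_ineq'`: consecutive chain
plaquettes are within `12 kH` of each other, and the windows `mW (cH j) kH` (boxes of radius
`48 kH`) consist of plaquettes touching `Λ` across every side (bulk coverage of the windows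
`supBox (w j) (50 κ)`), off the avoided set (the windows miss the middle and the end zones), and
inside the region `D` (box connectivity from the seed, `sqBox_subset_touchReach`).

All `[folklore]` glue; no named fact.

## References

* D. Chelkak, S. Smirnov, Invent. Math. 189 (2012) = arXiv:0910.2045, proof of Thm. 6.1. [ChelkakSmirnov2012Ising]
-/

noncomputable section

open Set Metric

namespace Literature.Probability.LatticeModels

open Site WeakBeurling

namespace KCSignConfig

variable {Ω G Bad : Set ℂ} (cfg : KCSignConfig Ω G Bad)

/-- The Harnack scale in lattice units, `kH = ⌊κ/δ⌋`. [folklore] -/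
def kH (δ : ℝ) : ℕ := ⌊cfg.κ / δ⌋₊

/-- The chain plaquettes `cH j = plaqOf (w j / δ)`. [folklore] -/
def cH (δ : ℝ) (j : ℕ) : Site 2 := plaqOf (cfg.w j / δ)

/-- The chain starts at the seed plaquette. [folklore] -/
theorem cH_zero (δ : ℝ) : cfg.cH δ 0 = cfg.f₀ δ := by rw [cH, cfg.w_zero, f₀]

/-- Floors of nearby reals are nearby. [folklore] -/
theorem abs_floor_sub_floor_le {a b r : ℝ} (h : |a - b| ≤ r) : |((⌊a⌋ - ⌊b⌋ : ℤ) : ℝ)| ≤ r + 1 := by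
  rw [abs_le] at h ⊢
  have ha := Int.floor_le a; have ha' := Int.lt_floor_add_one a
  have hb := Int.floor_le b; have hb' := Int.lt_floor_add_one b
  push_cast
  constructor <;> linarith

namespace ScaleHyp

variable {cfg} {δ μ : ℝ} {Λ : Finset (Site 2)} (H : ScaleHyp cfg δ Λ μ)
include H

/-- `κ/δ - 1 < kH ≤ κ/δ`. [folklore] -/
theorem kH_bounds : (cfg.kH δ : ℝ) ≤ cfg.κ / δ ∧ cfg.κ / δ < cfg.kH δ + 1 :=
  ⟨Nat.floor_le (div_nonneg cfg.κ_pos.le H.δ_pos.le), Nat.lt_floor_add_one _⟩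

/-- `100 ≤ κ/δ`. [folklore] -/
theorem hundred_le_κ_div : 100 ≤ cfg.κ / δ := by
  rw [le_div_iff₀ H.δ_pos]; linarith [H.δ_le_κ]

/-- **`hkH`**: `0 < kH`. [folklore] -/
theorem kH_pos : 0 < cfg.kH δ := by
  have h1 := H.kH_bounds.2
  have h2 := H.hundred_le_κ_div
  have : (0 : ℝ) < cfg.kH δ := by linarith
  exact_mod_cast this

/-- **`hHstep`**: consecutive chain plaquettes are within sup-distance `12 kH`. [folklore] -/
theorem cH_succ_mem_mB {j : ℕ} (hj : j < cfg.J) : cfg.cH δ (j + 1) ∈ mB (cfg.cH δ j) (cfg.kH δ) := by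
  obtain ⟨hre, him⟩ := cfg.w_step j hj
  have hδ := H.δ_pos
  have hk := H.kH_bounds
  have h100 := H.hundred_le_κ_div
  have hre' : |(cfg.w (j + 1) / δ).re - (cfg.w j / δ).re| ≤ 6 * cfg.κ / δ := by
    rw [Complex.div_ofReal_re, Complex.div_ofReal_re, ← sub_div, abs_div, abs_of_pos hδ, ← Complex.sub_re]
    exact div_le_div_of_nonneg_right hre hδ.le
  have him' : |(cfg.w (j + 1) / δ).im - (cfg.w j / δ).im| ≤ 6 * cfg.κ / δ := by
    rw [Complex.div_ofReal_im, Complex.div_ofReal_im, ← sub_div, abs_div, abs_of_pos hδ, ← Complex.sub_im]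
    exact div_le_div_of_nonneg_right him hδ.le
  have h0 := abs_floor_sub_floor_le hre'
  have h1 := abs_floor_sub_floor_le him'
  push_cast at h0 h1
  simp only [mB, cH, plaqOf_apply_zero, plaqOf_apply_one, Set.mem_setOf_eq]
  constructor
  · have : |((⌊(cfg.w (j + 1) / ↑δ).re⌋ - ⌊(cfg.w j / ↑δ).re⌋ : ℤ) : ℝ)| ≤ 12 * (cfg.kH δ : ℕ) := by
      have : 6 * cfg.κ / δ + 1 ≤ 12 * (cfg.kH δ : ℝ) := by
        have : 6 * cfg.κ / δ = 6 * (cfg.κ / δ) := by ring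
        linarith
      push_cast; linarith
    exact_mod_cast this
  · have : |((⌊(cfg.w (j + 1) / ↑δ).im⌋ - ⌊(cfg.w j / ↑δ).im⌋ : ℤ) : ℝ)| ≤ 12 * (cfg.kH δ : ℕ) := by
      have : 6 * cfg.κ / δ + 1 ≤ 12 * (cfg.kH δ : ℝ) := by
        have : 6 * cfg.κ / δ = 6 * (cfg.κ / δ) := by ring
        linarith
      push_cast; linarith
    exact_mod_cast this

/-- Points within `½` (both coordinates) of the centre of a window plaquette scale into the
continuum window `supBox (w j) (50 κ)`. [folklore] -/
theorem scale_mem_supBox_of_mem_mW {j : ℕ} {x : Site 2} (hx : x ∈ mW (cfg.cH δ j) (cfg.kH δ)) {w' : ℂ}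
    (hw' : |w'.re - (plaqCentre x).re| ≤ 1 / 2 ∧ |w'.im - (plaqCentre x).im| ≤ 1 / 2) :
    (δ : ℂ) * w' ∈ supBox (cfg.w j) (50 * cfg.κ) := by
  have hδ := H.δ_pos
  have hk := H.kH_bounds
  have h100 := H.hundred_le_κ_div
  obtain ⟨hx0, hx1⟩ := hx
  -- the centre of `cH j` is within `½` of `w j / δ`
  have hc := abs_sub_le_of_mem_plaqClosedSq (mem_plaqClosedSq_plaqOf (cfg.w j / δ))
  rw [← cH] at hc
  have hx0' : |((x 0 - cfg.cH δ j 0 : ℤ) : ℝ)| ≤ 48 * (cfg.kH δ : ℝ) := by exact_mod_cast hx0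
  have hx1' : |((x 1 - cfg.cH δ j 1 : ℤ) : ℝ)| ≤ 48 * (cfg.kH δ : ℝ) := by exact_mod_cast hx1
  push_cast at hx0' hx1'
  have key : ∀ (a c cj wj : ℝ) (xi ci : ℤ), |a - c| ≤ 1 / 2 → c = xi + 1 / 2 → cj = ci + 1 / 2 → |cj - wj| ≤ 1 / 2 →
      |((xi - ci : ℤ) : ℝ)| ≤ 48 * (cfg.kH δ : ℝ) → |δ * a - δ * wj| ≤ 50 * cfg.κ := by
    intro a c cj wj xi ci h1 h2 h3 h4 h5
    push_cast at h5
    rw [← mul_sub, abs_mul, abs_of_pos hδ]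
    have : |a - wj| ≤ 48 * (cfg.kH δ : ℝ) + 1 := by
      rw [abs_le] at h1 h4 h5 ⊢; constructor <;> linarith
    calc δ * |a - wj| ≤ δ * (48 * (cfg.kH δ : ℝ) + 1) := mul_le_mul_of_nonneg_left this hδ.le
      _ ≤ δ * (48 * (cfg.κ / δ) + cfg.κ / δ / 100 * 100 / 100 * 100) := by nlinarith
      _ ≤ 50 * cfg.κ := by
        field_simp
        nlinarith [cfg.κ_pos]
  refine ⟨?_, ?_⟩
  · have := key w'.re (plaqCentre x).re (plaqCentre (cfg.cH δ j)).re (cfg.w j / δ).re (x 0) (cfg.cH δ j 0) hw'.1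
      (by simp [plaqCentre]) (by simp [plaqCentre]) hc.1 (by exact_mod_cast hx0)
    simpa [Complex.mul_re, mul_div_cancel₀, hδ.ne'] using this
  · have := key w'.im (plaqCentre x).im (plaqCentre (cfg.cH δ j)).im (cfg.w j / δ).im (x 1) (cfg.cH δ j 1) hw'.2
      (by simp [plaqCentre]) (by simp [plaqCentre]) hc.2 (by exact_mod_cast hx1)
    simpa [Complex.mul_im, mul_div_cancel₀, hδ.ne'] using this

/-- **Window plaquettes touch `Λ` across every side** (their corners scale into
`supBox (w j) (50 κ) ⊆ Kbulk μ`). [folklore] -/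
theorem sideTouch_of_mem_mW {j : ℕ} (hj : j ≤ cfg.J) {x : Site 2} (hx : x ∈ mW (cfg.cH δ j) (cfg.kH δ)) (i : Fin 4) :
    SideTouch Λ x i := by
  refine Or.inl (H.bulk _ ?_)
  have hmem : (δ : ℂ) * toComplex (x + cornerOff i) ∈ supBox (cfg.w j) (50 * cfg.κ) := by
    refine H.scale_mem_supBox_of_mem_mW hx ⟨?_, ?_⟩
    · have h : cornerOff i 0 = 0 ∨ cornerOff i 0 = 1 := by fin_cases i <;> simp
      simp only [toComplex_re, plaqCentre, Pi.add_apply, Int.cast_add]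
      rcases h with h | h <;> rw [h] <;> norm_num [abs_le]
    · have h : cornerOff i 1 = 0 ∨ cornerOff i 1 = 1 := by fin_cases i <;> simp
      simp only [toComplex_im, plaqCentre, Pi.add_apply, Int.cast_add]
      rcases h with h | h <;> rw [h] <;> norm_num [abs_le]
  -- `supBox (w j) (50 κ) ⊆ Kbulk μ`
  refine Or.inl (Or.inl (Or.inl (Or.inl ?_)))
  exact Set.mem_biUnion (Finset.mem_range.2 (Nat.lt_succ_of_le hj)) hmem

/-- A plaquette whose closed square scales into a set missing the middle and the two
`(mInf e + μ/8)`-diamonds is not avoided. [folklore] -/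
theorem not_mem_CsetL_of_square {f : Site 2} {S : Set ℂ}
    (hS : ∀ x ∈ S, x ∉ cfg.Mset ∧ ∀ e, cfg.mInf e + μ / 8 < l1norm (x - cfg.z₀ e))
    (hf : ∀ w ∈ plaqClosedSq f, (δ : ℂ) * w ∈ S) : f ∉ cfg.CsetL δ Λ μ := by
  rintro ⟨w, hwf, hwC, -⟩
  obtain ⟨h1, h2⟩ := hS _ (hf w hwf)
  rcases H.scale_mem_of_mem_contourL hwC with h | ⟨e, he⟩
  · exact h1 h
  · exact absurd he (not_le.2 (h2 e))

/-- **Window plaquettes are not avoided.** [folklore] -/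
theorem not_mem_CsetL_of_mem_mW {j : ℕ} (hj : j ≤ cfg.J) {x : Site 2} (hx : x ∈ mW (cfg.cH δ j) (cfg.kH δ)) :
    x ∉ cfg.CsetL δ Λ μ := by
  refine H.not_mem_CsetL_of_square (S := supBox (cfg.w j) (50 * cfg.κ)) (fun y hy => ?_) fun w hw =>
    H.scale_mem_supBox_of_mem_mW hx ?_
  · obtain ⟨h1, h2, h3⟩ := cfg.window_mid j hj y hy
    refine ⟨?_, fun e => ?_⟩
    · rintro ((h | h) | h)
      · exact h1 h
      · exact h3 h
      · exact h2 h
    · have := cfg.window_end j hj y hy e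
      linarith [H.μ_le_slack]
  · obtain ⟨a1, a2, a3, a4⟩ := hw
    simp only [plaqCentre]
    constructor <;> (rw [abs_le]; constructor <;> linarith)

/-- **Windows lie in `D`** (induction along the chain: the seed window contains the seed, each
window contains the next chain plaquette, boxes of touching plaquettes off the avoided set are
reachable as soon as one of their plaquettes is). [folklore] -/
theorem mW_subset_Dreg {j : ℕ} (hj : j ≤ cfg.J) : ∀ x ∈ mW (cfg.cH δ j) (cfg.kH δ), x ∈ cfg.Dreg δ Λ μ := by
  induction j with
  | zero =>
    intro x hx
    rw [mW_eq_sqBox] at hx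
    refine sqBox_subset_touchReach H.f₀_not_mem_CsetL (fun f hf => H.sideTouch_of_mem_mW hj (by rwa [mW_eq_sqBox]))
      (fun f hf => H.not_mem_CsetL_of_mem_mW hj (by rwa [mW_eq_sqBox])) (c' := cfg.cH δ 0) ?_ ?_ x hx
    · simp [mem_sqBox]
    · rw [cH_zero]; exact self_mem_touchReach _ _ _
  | succ j ih =>
    intro x hx
    have hj' : j ≤ cfg.J := Nat.le_of_succ_le hj
    have hstep : cfg.cH δ (j + 1) ∈ cfg.Dreg δ Λ μ := ih hj' _ (mB_subset_mW (H.cH_succ_mem_mB hj))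
    rw [mW_eq_sqBox] at hx
    refine sqBox_subset_touchReach H.f₀_not_mem_CsetL (fun f hf => H.sideTouch_of_mem_mW hj (by rwa [mW_eq_sqBox]))
      (fun f hf => H.not_mem_CsetL_of_mem_mW hj (by rwa [mW_eq_sqBox])) (c' := cfg.cH δ (j + 1)) ?_ hstep x hx
    simp [mem_sqBox]

/-- **`hHbig`** in the form consumed by `kc_sign_condition_ineq'`. [folklore] -/
theorem hHbig : ∀ j, j ≤ cfg.J → ∀ z ∈ mW (cfg.cH δ j) (cfg.kH δ), z ∈ cfg.Dreg δ Λ μ ∧ ∀ i : Fin 4, SideTouch Λ z i :=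
  fun _ hj z hz => ⟨H.mW_subset_Dreg hj z hz, H.sideTouch_of_mem_mW hj hz⟩

/-- **`hHstep`** in the form consumed by `kc_sign_condition_ineq'`. [folklore] -/
theorem hHstep : ∀ j, j < cfg.J → cfg.cH δ (j + 1) ∈ mB (cfg.cH δ j) (cfg.kH δ) := fun _ hj => H.cH_succ_mem_mB hj

end ScaleHyp

end KCSignConfig

end Literature.Probability.LatticeModels
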